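import Summits.Langlands.Langlands.Theses.DyadicOddResidue

/-!
# BC3 birth skeleton — child `WeakAutomorphyFromOddRegularQ` of the BC2-redirect split of `DyadicOddResidue.SectorComplement`
(crux stmt-Langlands-18745; crux-strategist `cstrat-stmt-Langlands-18745-r1`, 2026-08-17)

`WeakAutomorphyFromOddRegularQ := OddRegularReciprocityQ → WeakGeometricAutomorphy` (texts inlined) — B_w
(Fontaine–Mazur–Langlands, a.e. form, for EVERY number field `K`, every `n ≥ 1`, every irreducible pinned-geometric
`ρ : Γ_K → GL_n(ℚ̄_ℓ)`; = PrimeSwitchSplit.WeakGeometricAutomorphy, stmt-Langlands-17414) GRANTED the route target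
X = the same statement on the sector `K = ℚ`, `n = 2`, `ρ` odd and Hodge–Tate regular, at every `ℓ`.  It is the
ONE new leaf of the split (the other five are verbatim PrimeSwitchSplit items); it is B_w with the route's sector
paid for by X, and is cut here along the two honest seams of that remainder:

* `stub_transportDegreeOne` — X ⇒ the sector statement over every `K` with `[K:ℚ] = 1` (pure base-field transport
  along the unique `K ≃+* ℚ`: framed Galois representations, places, Fontaine's pinned datum, labelled Hodge–Tate
  weights, oddness, cuspidal automorphic representation data and Satake parameters are all functorial in a ring
  isomorphism of the base field; a FORMALISATION debt of size M–L, no mathematics);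
* `stub_rankTwoDegreeOne_offParityRegularity` — (B)-weak for `GL₂` over `K` of degree one OFF the sector: `ρ` even
  (Fontaine–Mazur for even `ρ`: Calegari 2011 only for ordinary-distinguished residue, `p > 7`; in general OPEN) or
  `ρ` with a repeated labelled Hodge–Tate weight (odd: weight-one forms — Buzzard–Taylor 1999, Pilloni–Stroh 2016 in
  many residual cases; even: algebraic Maass forms / even icosahedral Artin — OPEN);
* `stub_otherRanksAndFields` — (B)-weak for every `(K, n)` with `¬([K:ℚ] = 1 ∧ n = 2)`: `GL₁` (class field theory +
  Weil 1956), `n ≥ 3` (BLGGT 2014 / ACC+ 2023 over CM fields under genericity), `K ≠ ℚ` (Hilbert / Bianchi modularity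
  lifting and beyond) — OPEN in general (ShimuraVarietyRealizationBarrier, TwistedEndoscopySelfDual, NonRegularWeight).

None of the three is the child (each misses a typed region), none is the summit or `SectorComplement` (no (A)-side,
no local–global compatibility, no reciprocity data) — stub probes in `bc/stubprobe_WeakAutomorphyFromOddRegularQ.lean`.
Shape: 3 NAMED stubs `stub_*` (the ONLY sorries of this file) and the kernel-checked composition
`WeakAutomorphyFromOddRegularQ_of : <stub₁-sig> → <stub₂-sig> → <stub₃-sig> → WeakAutomorphyFromOddRegularQ`
(hypotheses = the `_Goal.stub_*` mirrors, registered-skeleton shape; by-name sanity `example`).  Context = the route file's (the child is restated here VERBATIM from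
children.json; after `route edit --split` it is the route's own decl
`Summit.Langlands.Langlands.Theses.DyadicOddResidue.WeakAutomorphyFromOddRegularQ` and this local copy is deleted —
post-split version `post/birth_WeakAutomorphyFromOddRegularQ.lean` in the planner folder).
-/

noncomputable section

set_option linter.dupNamespace false

namespace Summit.Langlands.Langlands.Theses.DyadicOddResidue

open scoped BigOperators Topology Manifold Classical MeasureTheory ProbabilityTheory Matrix InnerProductSpace ComplexConjugate ContinuousMap
open Filter Set Function TopologicalSpace MeasureTheory

/-- child `WeakAutomorphyFromOddRegularQ` (children.json statement VERBATIM; deleted after the split, when the route file declares it). -/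
def WeakAutomorphyFromOddRegularQ : Prop :=
  (∀ (ℓ : ℕ) [Fact ℓ.Prime] (ρ : Literature.NumberTheory.GaloisRepresentations.FramedGaloisRep ℚ (PadicAlgCl ℓ) 2), ρ.toGaloisRep.IsIrreducible → ρ.IsOdd → (∀ᶠ v : IsDedekindDomain.HeightOneSpectrum (NumberField.RingOfIntegers ℚ) in Filter.cofinite, ρ.IsUnramifiedAt v) → (∀ (v : IsDedekindDomain.HeightOneSpectrum (NumberField.RingOfIntegers ℚ)) (hv : ((ℓ : ℕ) : NumberField.RingOfIntegers ℚ) ∈ v.asIdeal), (Literature.NumberTheory.PAdicHodge.fontainePstAdicCompletion v ℓ hv).IsDeRhamFramed (ρ.toLocal v) ∧ ∀ τ : v.adicCompletion ℚ →+* PadicAlgCl ℓ, Continuous τ → (ρ.labelledHodgeTateWeightsAt v (Literature.NumberTheory.PAdicHodge.fontainePstAdicCompletion v ℓ hv).algebra (Literature.NumberTheory.PAdicHodge.fontainePstAdicCompletion v ℓ hv).𝔅 τ).Nodup) → ∀ (hcpt : Literature.NumberTheory.Automorphic.isCompact_glFiniteIntegralLevel 2 ℚ) (ι : PadicAlgCl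 ℓ ≃+* ℂ), ∃ π : Literature.NumberTheory.Automorphic.CuspidalAutomorphicRepData 2 ℚ hcpt, π.1.IsLAlgebraic ∧ ∀ᶠ v : IsDedekindDomain.HeightOneSpectrum (NumberField.RingOfIntegers ℚ) in Filter.cofinite, Summit.Langlands.SatakeFrobCompatibleAt ι π.1 ρ v) → ∀ (K : Type) [Field K] [NumberField K] (n : ℕ) (hcpt : Literature.NumberTheory.Automorphic.isCompact_glFiniteIntegralLevel n K), 0 < n → ∀ (ℓ : ℕ) [Fact ℓ.Prime] (ι : PadicAlgCl ℓ ≃+* ℂ) (ρ : Literature.NumberTheory.GaloisRepresentations.FramedGaloisRep K (PadicAlgCl ℓ) n), ρ.toGaloisRep.IsIrreducible → ((∀ᶠ v : IsDedekindDomain.HeightOneSpectrum (NumberField.RingOfIntegers K) in cofinite, ρ.IsUnramifiedAt v) ∧ ∀ (v : IsDedekindDomain.HeightOneSpectrum (NumberField.RingOfIntegers K)) (hv : ((ℓ : ℕ) : NumberField.RingOfIntegers K) ∈ v.asIdeal), (Literature.NumberTheory.PAdicHodge.fontainePstAdicCompletion v ℓ hv).IsDeRhamFramed (ρ.toLocal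 v)) → ∃ π : Literature.NumberTheory.Automorphic.CuspidalAutomorphicRepData n K hcpt, π.1.IsLAlgebraic ∧ ∀ᶠ v : IsDedekindDomain.HeightOneSpectrum (NumberField.RingOfIntegers K) in cofinite, SatakeFrobCompatibleAt ι π.1 ρ v

namespace Cruxes.WeakAutomorphyFromOddRegularQ.Birth

/-- **stub 1 — base-field transport of X to every field of degree one (USES X; formalisation debt, no mathematics)**:
granted X (Fontaine–Mazur–Langlands, a.e. form, for odd Hodge–Tate-regular `ρ : Γ_ℚ → GL₂(ℚ̄_ℓ)`), the same holds
for every number field `K` with `[K:ℚ] = 1`, `n = 2`, `ρ` odd and Hodge–Tate regular: transport every clause along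
the unique ring isomorphism `K ≃+* ℚ` (Galois groups, places and completions, Fontaine's pinned datum and labelled
Hodge–Tate weights, complex conjugations, `GL₂(𝔸_K)`-automorphic data and Satake parameters are functorial in it).
Why it might fail: only a typing slip in one of the transported structures (e.g. `isCompact_glFiniteIntegralLevel 2 K`
vs `2 ℚ`, which is a hypothesis on both sides).  [cite: BuzzardGeeLMS2014, Conj. 3.2.2] -/
theorem stub_transportDegreeOne :
    (∀ (ℓ : ℕ) [Fact ℓ.Prime] (ρ : Literature.NumberTheory.GaloisRepresentations.FramedGaloisRep ℚ (PadicAlgCl ℓ) 2), ρ.toGaloisRep.IsIrreducible → ρ.IsOdd → (∀ᶠ v : IsDedekindDomain.HeightOneSpectrum (NumberField.RingOfIntegers ℚ) in Filter.cofinite, ρ.IsUnramifiedAt v) → (∀ (v : IsDedekindDomain.HeightOneSpectrum (NumberField.RingOfIntegers ℚ)) (hv : ((ℓ : ℕ) : NumberField.RingOfIntegers ℚ) ∈ v.asIdeal), (Literature.NumberTheory.PAdicHodge.fontainePstAdicCompletion v ℓ hv).IsDeRhamFramed (ρ.toLocal v) ∧ ∀ τ : v.adicCompletion ℚ →+* PadicAlgCl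 ℓ, Continuous τ → (ρ.labelledHodgeTateWeightsAt v (Literature.NumberTheory.PAdicHodge.fontainePstAdicCompletion v ℓ hv).algebra (Literature.NumberTheory.PAdicHodge.fontainePstAdicCompletion v ℓ hv).𝔅 τ).Nodup) → ∀ (hcpt : Literature.NumberTheory.Automorphic.isCompact_glFiniteIntegralLevel 2 ℚ) (ι : PadicAlgCl ℓ ≃+* ℂ), ∃ π : Literature.NumberTheory.Automorphic.CuspidalAutomorphicRepData 2 ℚ hcpt, π.1.IsLAlgebraic ∧ ∀ᶠ v : IsDedekindDomain.HeightOneSpectrum (NumberField.RingOfIntegers ℚ) in Filter.cofinite, Summit.Langlands.SatakeFrobCompatibleAt ι π.1 ρ v) → ∀ (K : Type) [Field K] [NumberField K] (n : ℕ) (hcpt : Literature.NumberTheory.Automorphic.isCompact_glFiniteIntegralLevel n K), 0 < n → ∀ (ℓ : ℕ) [Fact ℓ.Prime] (ι : PadicAlgCl ℓ ≃+* ℂ) (ρ : Literature.NumberTheory.GaloisRepresentations.FramedGaloisRep K (PadicAlgCl ℓ) n), ρ.toGaloisRep.IsIrreducible → ((∀ᶠ v : IsDedekindDomain.HeightOneSpectrum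 (NumberField.RingOfIntegers K) in cofinite, ρ.IsUnramifiedAt v) ∧ ∀ (v : IsDedekindDomain.HeightOneSpectrum (NumberField.RingOfIntegers K)) (hv : ((ℓ : ℕ) : NumberField.RingOfIntegers K) ∈ v.asIdeal), (Literature.NumberTheory.PAdicHodge.fontainePstAdicCompletion v ℓ hv).IsDeRhamFramed (ρ.toLocal v)) → Module.finrank ℚ K = 1 → (n = 2 ∧ ρ.IsOdd ∧ (∀ (v : IsDedekindDomain.HeightOneSpectrum (NumberField.RingOfIntegers K)) (hv : ((ℓ : ℕ) : NumberField.RingOfIntegers K) ∈ v.asIdeal) (τ : v.adicCompletion K →+* PadicAlgCl ℓ), Continuous τ → (ρ.labelledHodgeTateWeightsAt v (Literature.NumberTheory.PAdicHodge.fontainePstAdicCompletion v ℓ hv).algebra (Literature.NumberTheory.PAdicHodge.fontainePstAdicCompletion v ℓ hv).𝔅 τ).Nodup)) → ∃ π : Literature.NumberTheory.Automorphic.CuspidalAutomorphicRepData n K hcpt, π.1.IsLAlgebraic ∧ ∀ᶠ v : IsDedekindDomain.HeightOneSpectrum (NumberField.RingOfIntegers K) in cofinite, SatakeFrobCompatibleAt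 ι π.1 ρ v := by
  sorry

/-- **stub 2 — (B)-weak for `GL₂` over a field of degree one OFF the odd-regular sector (OPEN)**: irreducible
pinned-geometric `ρ : Γ_K → GL₂(ℚ̄_ℓ)`, `[K:ℚ] = 1`, which is EVEN or has a REPEATED labelled Hodge–Tate weight at some
`v ∣ ℓ`, is Satake–Frobenius compatible a.e. with an L-algebraic cuspidal `π` of `GL₂(𝔸_K)`.  In print: odd with
equal weights = classical weight one (Buzzard–Taylor 1999, Buzzard 2003, Pilloni–Stroh 2016: many residual cases);
even `ρ` with distinct weights: Calegari 2011 Thm 1.1–1.2 (ordinary-distinguished residue, `p > 7`) and void in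
regular weight by Calegari's argument where it applies; even with equal weights = algebraic Maass forms (even Artin:
open beyond solvable / a few icosahedral cases).  Why it might fail: it contains the even Fontaine–Mazur conjecture and
Langlands–Tunnell-free even Artin.  [cite: Calegari2011, Thm. 1.1] [cite: BuzzardTaylor1999, Thm.] [cite: FontaineMazurGeometric1995, Conj. 1] -/
theorem stub_rankTwoDegreeOne_offParityRegularity :
    ∀ (K : Type) [Field K] [NumberField K] (n : ℕ) (hcpt : Literature.NumberTheory.Automorphic.isCompact_glFiniteIntegralLevel n K), 0 < n → ∀ (ℓ : ℕ) [Fact ℓ.Prime] (ι : PadicAlgCl ℓ ≃+* ℂ) (ρ : Literature.NumberTheory.GaloisRepresentations.FramedGaloisRep K (PadicAlgCl ℓ) n), ρ.toGaloisRep.IsIrreducible → ((∀ᶠ v : IsDedekindDomain.HeightOneSpectrum (NumberField.RingOfIntegers K) in cofinite, ρ.IsUnramifiedAt v) ∧ ∀ (v : IsDedekindDomain.HeightOneSpectrum (NumberField.RingOfIntegers K)) (hv : ((ℓ : ℕ) : NumberField.RingOfIntegers K) ∈ v.asIdeal), (Literature.NumberTheory.PAdicHodge.fontainePstAdicCompletion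 v ℓ hv).IsDeRhamFramed (ρ.toLocal v)) → Module.finrank ℚ K = 1 → n = 2 → ¬ (ρ.IsOdd ∧ (∀ (v : IsDedekindDomain.HeightOneSpectrum (NumberField.RingOfIntegers K)) (hv : ((ℓ : ℕ) : NumberField.RingOfIntegers K) ∈ v.asIdeal) (τ : v.adicCompletion K →+* PadicAlgCl ℓ), Continuous τ → (ρ.labelledHodgeTateWeightsAt v (Literature.NumberTheory.PAdicHodge.fontainePstAdicCompletion v ℓ hv).algebra (Literature.NumberTheory.PAdicHodge.fontainePstAdicCompletion v ℓ hv).𝔅 τ).Nodup)) → ∃ π : Literature.NumberTheory.Automorphic.CuspidalAutomorphicRepData n K hcpt, π.1.IsLAlgebraic ∧ ∀ᶠ v : IsDedekindDomain.HeightOneSpectrum (NumberField.RingOfIntegers K) in cofinite, SatakeFrobCompatibleAt ι π.1 ρ v := by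
  sorry

/-- **stub 3 — (B)-weak in every other rank / over every other field (OPEN)**: irreducible pinned-geometric
`ρ : Γ_K → GL_n(ℚ̄_ℓ)` with `¬ ([K:ℚ] = 1 ∧ n = 2)`: `GL₁` (class field theory + Weil 1956), `n ≥ 3` (BLGGT 2014,
ACC+ 2023 over CM fields under genericity), `K ≠ ℚ` (Hilbert / Bianchi modularity lifting and beyond); open in general
(ShimuraVarietyRealizationBarrier, TwistedEndoscopySelfDual, NonRegularWeightBarrier).
[cite: FontaineMazurGeometric1995, Conj. 1] [cite: BarnetlambEtAl2014, Thm. A] [cite: ACCGHLNSTT2023, Thm. 1.0.1] -/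
theorem stub_otherRanksAndFields :
    ∀ (K : Type) [Field K] [NumberField K] (n : ℕ) (hcpt : Literature.NumberTheory.Automorphic.isCompact_glFiniteIntegralLevel n K), 0 < n → ∀ (ℓ : ℕ) [Fact ℓ.Prime] (ι : PadicAlgCl ℓ ≃+* ℂ) (ρ : Literature.NumberTheory.GaloisRepresentations.FramedGaloisRep K (PadicAlgCl ℓ) n), ρ.toGaloisRep.IsIrreducible → ((∀ᶠ v : IsDedekindDomain.HeightOneSpectrum (NumberField.RingOfIntegers K) in cofinite, ρ.IsUnramifiedAt v) ∧ ∀ (v : IsDedekindDomain.HeightOneSpectrum (NumberField.RingOfIntegers K)) (hv : ((ℓ : ℕ) : NumberField.RingOfIntegers K) ∈ v.asIdeal), (Literature.NumberTheory.PAdicHodge.fontainePstAdicCompletion v ℓ hv).IsDeRhamFramed (ρ.toLocal v)) → ¬ (Module.finrank ℚ K = 1 ∧ n = 2) → ∃ π : Literature.NumberTheory.Automorphic.CuspidalAutomorphicRepData n K hcpt, π.1.IsLAlgebraic ∧ ∀ᶠ v : IsDedekindDomain.HeightOneSpectrum (NumberField.RingOfIntegers K) in cofinite, SatakeFrobCompatibleAt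 ι π.1 ρ v := by
  sorry

namespace _Goal

/-- The statement of `stub_transportDegreeOne` (literally its type). [folklore] -/
def stub_transportDegreeOne : Prop :=
  type_of% @Summit.Langlands.Langlands.Theses.DyadicOddResidue.Cruxes.WeakAutomorphyFromOddRegularQ.Birth.stub_transportDegreeOne

/-- The statement of `stub_rankTwoDegreeOne_offParityRegularity` (literally its type). [folklore] -/
def stub_rankTwoDegreeOne_offParityRegularity : Prop :=
  type_of% @Summit.Langlands.Langlands.Theses.DyadicOddResidue.Cruxes.WeakAutomorphyFromOddRegularQ.Birth.stub_rankTwoDegreeOne_offParityRegularity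

/-- The statement of `stub_otherRanksAndFields` (literally its type). [folklore] -/
def stub_otherRanksAndFields : Prop :=
  type_of% @Summit.Langlands.Langlands.Theses.DyadicOddResidue.Cruxes.WeakAutomorphyFromOddRegularQ.Birth.stub_otherRanksAndFields

end _Goal

/-- **The child from its three stubs** (case split on `[K:ℚ] = 1 ∧ n = 2`, then on `odd ∧ regular`; X is threaded to stub 1 only). -/
theorem WeakAutomorphyFromOddRegularQ_of (h1 : _Goal.stub_transportDegreeOne)
    (h2 : _Goal.stub_rankTwoDegreeOne_offParityRegularity) (h3 : _Goal.stub_otherRanksAndFields) :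
    WeakAutomorphyFromOddRegularQ := by
  dsimp only [_Goal.stub_transportDegreeOne, _Goal.stub_rankTwoDegreeOne_offParityRegularity,
    _Goal.stub_otherRanksAndFields] at h1 h2 h3
  intro hX K _ _ n hcpt hn ℓ _ ι ρ hirr hgeo
  by_cases hK : Module.finrank ℚ K = 1 ∧ n = 2
  · by_cases hs : (ρ.IsOdd ∧ (∀ (v : IsDedekindDomain.HeightOneSpectrum (NumberField.RingOfIntegers K)) (hv : ((ℓ : ℕ) : NumberField.RingOfIntegers K) ∈ v.asIdeal) (τ : v.adicCompletion K →+* PadicAlgCl ℓ), Continuous τ → (ρ.labelledHodgeTateWeightsAt v (Literature.NumberTheory.PAdicHodge.fontainePstAdicCompletion v ℓ hv).algebra (Literature.NumberTheory.PAdicHodge.fontainePstAdicCompletion v ℓ hv).𝔅 τ).Nodup))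
    · exact h1 hX K n hcpt hn ℓ ι ρ hirr hgeo hK.1 ⟨hK.2, hs⟩
    · exact h2 K n hcpt hn ℓ ι ρ hirr hgeo hK.1 hK.2 hs
  · exact h3 K n hcpt hn ℓ ι ρ hirr hgeo hK

/-- by-name sanity check: the composition with the stubs plugged in. -/
example : WeakAutomorphyFromOddRegularQ :=
  WeakAutomorphyFromOddRegularQ_of stub_transportDegreeOne stub_rankTwoDegreeOne_offParityRegularity stub_otherRanksAndFields

end Cruxes.WeakAutomorphyFromOddRegularQ.Birth

end Summit.Langlands.Langlands.Theses.DyadicOddResidue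

end
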